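import Summits.AtomisticToContinuum.Crystallization.Theorems.DisclinationRationUniformPolytypeStabilityChainIdentityFnl

/-!
# `UniformPolytypeStability` (stmt-AtomisticToContinuum-15800), line `birth` (v3, cells / far field): chain identity, II

Route `DisclinationRation`, crux `UniformPolytypeStability`, line `birth` (lead prover-line-stmt-AtomisticToContinuum-15800-0).
Second helper file of the stubs `stub_chainIdentity` / `stub_planeChainIdentity` (soundness of the rational chain checker
of `…FarChains.lean`): the real-side geometry and arithmetic.

* DUAL FRAME (`inner_gradVec_frameVec`): `⟨∇λ(ĝ), frameVec c⟩ = ĝ · c` — the cell dual frame `b^j` (`dualVec`) is dual to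
  the slab frame `(σ v₁, σ v₂, σ w + h_k e₃)` (`a ≠ 0`, `h_k ≠ 0`, `σ = ±1`); hence the oblique coordinates of the steep
  slab direction `dirReal` ARE `dirVec` (`inner_gradVec_dirReal`) and those of the in-plane vector `planeVec a q` are
  `(σ q₁, σ q₂, 0)` (`inner_gradVec_planeVec`).
* ONE PIECE, ONE SLAB (`piece_term`, `slab_identity`): with the affinity of `tetFnl` and the telescoping of file I,
  `Σ_pieces (s₁ − s₀) • F_T(d) = eval φ (exitFnl) − eval φ (entryFnl)` for every valuation `φ` matching the cells.
* REGISTRY ARITHMETIC (`regShift_succ`, `reg3_lt`, `reg3_cast`, `reg_step`): `C_{l+1} = C_l + s (m + l)`, and the checker's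
  `nextC (C_l mod 3) σ_l` is `(C_{l+1} mod 3, K_{l+1} − K_l)` with `K_l = (C_l − C_l mod 3)/3` (floor conventions of `Int`).
* Unpacking of `checkSteep` / `checkPlane` into their conjuncts (`checkSteep_spec`, `checkPlane_spec`).

Everything is `[folklore]`; helper lemmas live in the sub-namespace `StubChain`; the registered anchor is
`stub_chainIdentityAux2` (the dual-frame identity on the third frame vector).
-/

noncomputable section

namespace Summit.AtomisticToContinuum.Crystallization.Theorems.UniformPolytypeStabilityCells

open scoped BigOperators InnerProductSpace
open Literature.MathematicalPhysics.StatisticalMechanics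
open FarChain

namespace StubChain

/-! ## The dual frame -/

section Frame

variable (a : ℝ) (s : ℤ → ℤ) (z : ℤ → ℝ) (k : ℤ)

/-- Coordinates of `frameVec a s z k c₁ c₂ c₃ = c₁ σv₁ + c₂ σv₂ + c₃ (σw + h e₃)`. [folklore] -/
theorem frameVec_apply (c₁ c₂ c₃ : ℝ) :
    frameVec a s z k c₁ c₂ c₃ 0 = (s k : ℝ) * a * (c₁ + c₂ / 2 + c₃ / 2) ∧
      frameVec a s z k c₁ c₂ c₃ 1 = (s k : ℝ) * a * Real.sqrt 3 * (c₂ / 2 + c₃ / 6) ∧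
        frameVec a s z k c₁ c₂ c₃ 2 = c₃ * gap z k := by
  refine ⟨?_, ?_, ?_⟩ <;>
    simp [frameVec, triangularVec₁, triangularVec₂, barlowOffset, layerNormal] <;> ring

/-- Coordinates of `gradVec a s z k ĝ = Σ_j ĝ_j b^j`. [folklore] -/
theorem gradVec_apply (g : ℤ × ℤ × ℤ) :
    gradVec a s z k g 0 = (g.1 : ℝ) * ((s k : ℝ) / a) ∧
      gradVec a s z k g 1 =
          (g.1 : ℝ) * (-(s k : ℝ) / (a * Real.sqrt 3)) + (g.2.1 : ℝ) * (2 * (s k : ℝ) / (a * Real.sqrt 3)) ∧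
        gradVec a s z k g 2 =
          (g.1 : ℝ) * (-1 / (3 * gap z k)) + (g.2.1 : ℝ) * (-1 / (3 * gap z k)) + (g.2.2 : ℝ) * (1 / gap z k) := by
  refine ⟨?_, ?_, ?_⟩ <;> simp [gradVec, dualVec]

variable {a s z k}

/-- **The dual frame**: `⟨Σ_j ĝ_j b^j, c₁ σv₁ + c₂ σv₂ + c₃ (σw + h e₃)⟩ = ĝ₁ c₁ + ĝ₂ c₂ + ĝ₃ c₃`
(`b^i · a_j = δ_ij` for `a ≠ 0`, `h ≠ 0`, `σ = ±1`). [folklore] -/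
theorem inner_gradVec_frameVec (ha : a ≠ 0) (hk : gap z k ≠ 0) (hs : s k = 1 ∨ s k = -1)
    (g : ℤ × ℤ × ℤ) (c₁ c₂ c₃ : ℝ) :
    inner ℝ (gradVec a s z k g) (frameVec a s z k c₁ c₂ c₃) =
      (g.1 : ℝ) * c₁ + (g.2.1 : ℝ) * c₂ + (g.2.2 : ℝ) * c₃ := by
  obtain ⟨f0, f1, f2⟩ := frameVec_apply a s z k c₁ c₂ c₃
  obtain ⟨e0, e1, e2⟩ := gradVec_apply a s z k g
  have h3 : Real.sqrt 3 ≠ 0 := by positivity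
  simp only [PiLp.inner_apply, RCLike.inner_apply, conj_trivial, Fin.sum_univ_three, f0, f1, f2, e0, e1, e2]
  rcases hs with h | h <;> simp only [h, Int.cast_one, Int.cast_neg] <;> field_simp <;> ring

/-- The letter of slab `k` as an integer sign is `s k`. [folklore] -/
theorem sgnZ_letterB (hs : s k = 1 ∨ s k = -1) : sgnZ (letterB s k) = s k := by
  unfold sgnZ letterB
  rcases hs with h | h <;> simp [h]

/-- The letter of slab `k` as a rational sign is `s k`. [folklore] -/
theorem sgnQ_letterB (hs : s k = 1 ∨ s k = -1) : sgnQ (letterB s k) = (s k : ℚ) := by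
  unfold sgnQ letterB
  rcases hs with h | h <;> simp [h]

/-- The oblique coordinates of the steep slab direction `dirReal` are `dirVec`:
`⟨∇λ(ĝ), d_l⟩ = ⟨ĝ, dirVec⟩_ℚ`. [folklore] -/
theorem inner_gradVec_dirReal (ha : a ≠ 0) (hk : gap z k ≠ 0) (hs : s k = 1 ∨ s k = -1)
    (g : ℤ × ℤ × ℤ) (dm : ℕ) (q3 : ℤ × ℤ) :
    inner ℝ (gradVec a s z k g) (dirReal a s z k dm q3) =
      ((Q3.dot (gradQ g) (dirVec dm q3 (letterB s k)) : ℚ) : ℝ) := by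
  unfold dirReal
  rw [inner_gradVec_frameVec ha hk hs]
  simp only [Q3.dot, gradQ, dirVec]
  push_cast
  ring

/-- The in-plane class vector in the slab frame: `q₁ v₁ + q₂ v₂ = (σq₁) σv₁ + (σq₂) σv₂`. [folklore] -/
theorem planeVec_eq_frameVec (hs : s k = 1 ∨ s k = -1) (q : ℤ × ℤ) :
    planeVec a q = frameVec a s z k ((s k : ℝ) * q.1) ((s k : ℝ) * q.2) 0 := by
  rcases hs with h | h <;> simp [planeVec, frameVec, h, smul_smul]

/-- The oblique coordinates of the in-plane class vector are `(σ q₁, σ q₂, 0)`. [folklore] -/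
theorem inner_gradVec_planeVec (ha : a ≠ 0) (hk : gap z k ≠ 0) (hs : s k = 1 ∨ s k = -1)
    (g : ℤ × ℤ × ℤ) (q : ℤ × ℤ) :
    inner ℝ (gradVec a s z k g) (planeVec a q) =
      ((Q3.dot (gradQ g) ⟨sgnQ (letterB s k) * q.1, sgnQ (letterB s k) * q.2, 0⟩ : ℚ) : ℝ) := by
  rw [planeVec_eq_frameVec (a := a) (z := z) hs, inner_gradVec_frameVec ha hk hs, sgnQ_letterB hs]
  simp only [Q3.dot, gradQ]
  push_cast
  ring

end Frame

/-! ## One piece, one slab -/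

section Slab

variable {a : ℝ} {s : ℤ → ℤ} {z : ℤ → ℝ}

/-- **One piece**: if `d` has oblique coordinates `D` in the slab of the cell `ι` and the valuation `φ` reads the corners of
cube `N` as the vertices of `ι`, then `(s₁ − s₀) • F_T(d) = A_T(E + s₁ D) − A_T(E + s₀ D)`. [folklore] -/
theorem piece_term (U : Idx → EuclideanSpace ℝ (Fin 3)) (φ : ℤ × ℤ × ℤ → EuclideanSpace ℝ (Fin 3))
    (ι : CIdx) (t : ℕ) (N : ℤ × ℤ) (d : EuclideanSpace ℝ (Fin 3)) (E D : Q3) (s₀ s₁ : ℚ)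
    (hD : ∀ g, inner ℝ (gradVec a s z ι.1 g) d = ((Q3.dot (gradQ g) D : ℚ) : ℝ))
    (hφ : ∀ v : Corner, φ (N.1 + ((v.1 : ℕ) : ℤ), N.2 + ((v.2.1 : ℕ) : ℤ), ((v.2.2 : ℕ) : ℤ)) = U (cvert s ι v)) :
    ((s₁ - s₀ : ℚ) : ℝ) • tetApply a s z U ι t d =
      eval φ (tetFnl N t (pointAt E D s₁)) - eval φ (tetFnl N t (pointAt E D s₀)) := by
  rw [eval_tetFnl_sub, tetApply, List.smul_sum, List.map_map]
  congr 1
  refine List.map_congr_left fun vg _ => ?_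
  have hdot : Q3.dot (gradQ vg.2) (Q3.sub (pointAt E D s₁) (pointAt E D s₀)) = (s₁ - s₀) * Q3.dot (gradQ vg.2) D := by
    simp only [Q3.dot, Q3.sub, pointAt, Q3.add, Q3.smul]
    ring
  simp only [Function.comp_apply, hD, hφ, smul_smul, hdot, Rat.cast_mul]

/-- **One slab**: for a checked piece list, the weighted affine-gradient actions sum to `eval (exitFnl) − eval (entryFnl)`. [folklore] -/
theorem slab_identity (U : Idx → EuclideanSpace ℝ (Fin 3)) (φ : ℤ × ℤ × ℤ → EuclideanSpace ℝ (Fin 3))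
    (E D : Q3) (ps : List Piece) (cell : Piece → CIdx) (d : EuclideanSpace ℝ (Fin 3))
    (hps : checkPieces E D ps = true)
    (hD : ∀ p ∈ ps, ∀ g, inner ℝ (gradVec a s z (cell p).1 g) d = ((Q3.dot (gradQ g) D : ℚ) : ℝ))
    (hφ : ∀ p ∈ ps, ∀ v : Corner,
      φ (p.cube.1 + ((v.1 : ℕ) : ℤ), p.cube.2 + ((v.2.1 : ℕ) : ℤ), ((v.2.2 : ℕ) : ℤ)) = U (cvert s (cell p) v)) :
    (ps.map fun p => ((p.s1 - p.s0 : ℚ) : ℝ) • tetApply a s z U (cell p) p.tet d).sum =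
      eval φ (exitFnl E D ps) - eval φ (entryFnl E D ps) := by
  rw [← pieces_telescope φ E D ps hps]
  congr 1
  refine List.map_congr_left fun p hp => ?_
  exact piece_term U φ (cell p) p.tet p.cube d E D p.s0 p.s1 (hD p hp) (hφ p hp)

end Slab

/-! ## Registry arithmetic -/

section Registry

variable (s : ℤ → ℤ) (m : ℤ)

/-- No registry shift after zero layers. [folklore] -/
theorem regShift_zero : regShift s m 0 = 0 := by
  simp [regShift]

/-- `reg3 s m 0 = 0`. [folklore] -/
theorem reg3_zero : reg3 s m 0 = 0 := by
  simp [reg3, regShift_zero]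

/-- `C_{l+1} = C_l + s (m + l)` (`haggLabel_succ`). [folklore] -/
theorem regShift_succ (l : ℕ) : regShift s m (l + 1) = regShift s m l + s (m + l) := by
  simp only [regShift, Nat.cast_succ, ← add_assoc, haggLabel_succ]
  ring

/-- `reg3 < 3`. [folklore] -/
theorem reg3_lt (l : ℕ) : reg3 s m l < 3 := by
  unfold reg3
  omega

/-- `reg3` is the registry shift modulo `3`. [folklore] -/
theorem reg3_cast (l : ℕ) : ((reg3 s m l : ℕ) : ℤ) = regShift s m l % 3 := by
  unfold reg3
  omega

variable {s} in
/-- **The hand-over arithmetic**: `nextC (C_l mod 3) σ_l = (C_{l+1} mod 3, K_{l+1} − K_l)` with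
`K_l = (C_l − C_l mod 3) / 3`. [folklore] -/
theorem reg_step (hs : IsHaggSeq s) (l : ℕ) :
    (nextC (reg3 s m l) (letterB s (m + l))).1 = reg3 s m (l + 1) ∧
      (regShift s m (l + 1) - (reg3 s m (l + 1) : ℤ)) / 3 =
        (regShift s m l - (reg3 s m l : ℤ)) / 3 + (nextC (reg3 s m l) (letterB s (m + l))).2 := by
  have hσ := sgnZ_letterB (hs (m + l))
  simp only [nextC, reg3, regShift_succ, hσ]
  rcases hs (m + l) with h | h <;> rw [h] <;> omega

end Registry

/-! ## Unpacking the checks -/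

/-- Every `c < 3` is in the checker's list `[0, 1, 2]`. [folklore] -/
theorem mem_three (c : ℕ) (hc : c < 3) : c ∈ [0, 1, 2] := by
  interval_cases c <;> simp

/-- Every Boolean is in the checker's list `[true, false]`. [folklore] -/
theorem mem_bool (σ : Bool) : σ ∈ [true, false] := by
  cases σ <;> simp

/-- The conjuncts of `checkSteep dm q3 = true`. [folklore] -/
theorem checkSteep_spec (dm : ℕ) (q3 : ℤ × ℤ) (h : checkSteep dm q3 = true) :
    0 < dm ∧
    (∀ l, l < dm → ∀ c3, c3 < 3 → ∀ σ, checkSlabVariant dm q3 l c3 σ = true) ∧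
    (∀ σ, Fnl.beq (slabEntry dm q3 0 0 σ 0) [((0, 0, 0), 1)] = true) ∧
    (∀ l, l + 1 < dm → ∀ c3, c3 < 3 → ∀ σ σ', Fnl.beq (slabExit dm q3 l c3 σ 0)
      (slabEntry dm q3 (l + 1) (nextC c3 σ).1 σ' (nextC c3 σ).2) = true) ∧
    (∀ c3, c3 < 3 → ∀ σ, (q3.1 - ((nextC c3 σ).1 : ℤ)) % 3 = 0 → (q3.2 - ((nextC c3 σ).1 : ℤ)) % 3 = 0 →
      Fnl.beq (slabExit dm q3 (dm - 1) c3 σ 0)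
        [(((dm : ℤ), (q3.1 - (nextC c3 σ).1) / 3 - (nextC c3 σ).2, (q3.2 - (nextC c3 σ).1) / 3 - (nextC c3 σ).2), 1)]
        = true) := by
  simp only [checkSteep, Bool.and_eq_true, decide_eq_true_eq, List.all_eq_true, List.mem_range] at h
  obtain ⟨⟨⟨⟨h0, h1⟩, h2⟩, h3⟩, h4⟩ := h
  refine ⟨h0, fun l hl c3 hc σ => h1 l hl c3 (mem_three c3 hc) σ (mem_bool σ),
    fun σ => h2 σ (mem_bool σ),
    fun l hl c3 hc σ σ' => h3 l (by omega) c3 (mem_three c3 hc) σ (mem_bool σ) σ' (mem_bool σ'),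
    fun c3 hc σ e1 e2 => ?_⟩
  have := h4 c3 (mem_three c3 hc) σ (mem_bool σ)
  rw [if_pos ⟨e1, e2⟩] at this
  exact this

/-- The conjuncts of `checkPlane q = true` for the letter `σ`. [folklore] -/
theorem checkPlane_spec (q : ℤ × ℤ) (h : checkPlane q = true) (σ : Bool) :
    checkPieces ⟨0, 0, 0⟩ ⟨sgnQ σ * q.1, sgnQ σ * q.2, 0⟩ (planePieces q σ) = true ∧
      Fnl.beq (toSites 0 σ 0 (entryFnl ⟨0, 0, 0⟩ ⟨sgnQ σ * q.1, sgnQ σ * q.2, 0⟩ (planePieces q σ)))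
        [((0, 0, 0), 1)] = true ∧
      Fnl.beq (toSites 0 σ 0 (exitFnl ⟨0, 0, 0⟩ ⟨sgnQ σ * q.1, sgnQ σ * q.2, 0⟩ (planePieces q σ)))
        [((0, q.1, q.2), 1)] = true := by
  simp only [checkPlane, Bool.and_eq_true, decide_eq_true_eq, List.all_eq_true] at h
  obtain ⟨⟨h1, h2⟩, h3⟩ := h.2 σ (mem_bool σ)
  exact ⟨h1, h2, h3⟩

end StubChain

/-! ## Anchor -/

open StubChain in
/-- Registered anchor of this helper file (`stub_chainIdentityAux2`): the dual-frame identity on the third slab frame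
vector, `⟨∇λ(ĝ), σw + h_k e₃⟩ = ĝ₃`. [folklore] -/
theorem stub_chainIdentityAux2 : ∀ (a : ℝ) (s : ℤ → ℤ) (z : ℤ → ℝ) (k : ℤ) (g : ℤ × ℤ × ℤ),
    a ≠ 0 → gap z k ≠ 0 → IsHaggSeq s → inner ℝ (gradVec a s z k g) (frameVec a s z k 0 0 1) = g.2.2 := by
  intro a s z k g ha hk hs
  rw [inner_gradVec_frameVec ha hk (hs k)]
  ring

end Summit.AtomisticToContinuum.Crystallization.Theorems.UniformPolytypeStabilityCells

end
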